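import Literature.Analysis.FluidPDE.SourcedScalarBudget

/-!
# The weighted Cesàro field of a weak sourced scalar (condensate theorem, stub D)

Crux `TwoAndHalfD.TwohalfdNeg` (stmt-AnomalousDissipation-0211), line
`log-kantorovich-enstrophy-transfer`, condensate theorem (lead c6).  For a global weak sourced
scalar `θ` (`Torus.IsWeakScalarTransportForced κ u (fun _ => h) θ₀ θ`: `θ ∈ L^∞_t L²_x` on every
`(0,T)`, jointly measurable) and `T > 0`, the un-normalised WEIGHTED CESÀRO FIELD
`Θ_T(x) = ∫₀ᵀ (T − τ) θ(τ, x) dτ` (weight `T − τ ≥ 0` of total mass `T²/2`) satisfies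

* `Θ_T ∈ L²(T²)`;
* `∫ Θ_T² ≤ (T²/2) ∫₀ᵀ (T − τ) ‖θ(τ)‖²_{L²} dτ` (weighted Cauchy–Schwarz in `τ` at a.e. `x`, then
  Tonelli);
* `∫ Θ_T ψ = ∫₀ᵀ (T − τ) ∫ θ(τ) ψ dτ` for every continuous `ψ` (Fubini).

Everything lives on `(0,T) × T²`, where `θ` and `θ²` are integrable for the product measure
(`IsWeakScalarTransportForcedOn.integrable_uncurry` and the `L^∞_t L²_x` bound); interval
integrals `∫ τ in 0..T` are integrals over `volume.restrict (Ioo 0 T)`.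

* `cesaroField_weight_integral` — `∫_{(0,T)} (T − τ) dτ = T²/2`;
* `cesaroField_sq_integral_le` — the weighted Cauchy–Schwarz inequality
  `(∫_{(0,T)} (T−τ) f)² ≤ (T²/2) ∫_{(0,T)} (T−τ) f²` (elementary: `∫ (T−τ)(a f − b)² ≥ 0`);
* `cesaroField_integrable_sq`, `cesaroField_integrable_weight_mul` — product integrability of
  `θ²` and of `(T − τ) F` for integrable `F`;
* `stub_condensateCesaroField` — the registered stub (last declaration).

Supports stmt-AnomalousDissipation-0211.
-/

namespace Summit.AnomalousDissipation.AnomalousDissipation.Theorems.TwohalfdNeg.Condensate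

open MeasureTheory Filter Topology
open scoped ENNReal NNReal InnerProductSpace
open Literature.Analysis.FunctionSpaces Literature.Analysis.FluidPDE

set_option linter.dupNamespace false

/-! ## Scalar tools on the time interval `(0, T)` -/

/-- The total mass of the Cesàro weight: `∫_{(0,T)} (T − τ) dτ = T²/2` for `0 ≤ T`. [folklore] -/
theorem cesaroField_weight_integral {T : ℝ} (hT : 0 ≤ T) :
    ∫ τ in Set.Ioo 0 T, (T - τ) = T ^ 2 / 2 := by
  rw [← integral_Ioc_eq_integral_Ioo, ← intervalIntegral.integral_of_le hT,
    intervalIntegral.integral_sub intervalIntegrable_const intervalIntegral.intervalIntegrable_id,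
    intervalIntegral.integral_const, integral_id]
  simp only [sub_zero, smul_eq_mul]
  ring

/-- **Weighted Cauchy–Schwarz / Jensen on `(0,T)`.** If `(T − τ) f` and `(T − τ) f²` are
integrable on `(0,T)`, then `(∫_{(0,T)} (T − τ) f)² ≤ (T²/2) ∫_{(0,T)} (T − τ) f²`
(expand `0 ≤ ∫ (T − τ)(a f − b)²` with `a = T²/2`, `b = ∫ (T − τ) f`). [folklore] -/
theorem cesaroField_sq_integral_le {T : ℝ} (hT : 0 < T) {f : ℝ → ℝ}
    (h1 : Integrable (fun τ => (T - τ) * f τ) (volume.restrict (Set.Ioo 0 T)))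
    (h2 : Integrable (fun τ => (T - τ) * f τ ^ 2) (volume.restrict (Set.Ioo 0 T))) :
    (∫ τ in Set.Ioo 0 T, (T - τ) * f τ) ^ 2 ≤ T ^ 2 / 2 * ∫ τ in Set.Ioo 0 T, (T - τ) * f τ ^ 2 := by
  set a : ℝ := T ^ 2 / 2 with ha_def
  set b : ℝ := ∫ τ in Set.Ioo 0 T, (T - τ) * f τ with hb_def
  set c : ℝ := ∫ τ in Set.Ioo 0 T, (T - τ) * f τ ^ 2 with hc_def
  have ha : 0 < a := by positivity
  have h0 : Integrable (fun τ : ℝ => T - τ) (volume.restrict (Set.Ioo 0 T)) :=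
    ((by fun_prop : Continuous fun τ : ℝ => T - τ).integrableOn_Icc (a := 0) (b := T)).mono_set
      Set.Ioo_subset_Icc_self
  have hnn : 0 ≤ ∫ τ in Set.Ioo 0 T, (T - τ) * (a * f τ - b) ^ 2 :=
    setIntegral_nonneg measurableSet_Ioo fun τ hτ => mul_nonneg (by linarith [hτ.2]) (sq_nonneg _)
  have e : ∫ τ in Set.Ioo 0 T, (T - τ) * (a * f τ - b) ^ 2 = a * (a * c - b ^ 2) := by
    have e1 : (fun τ => (T - τ) * (a * f τ - b) ^ 2) =
        fun τ => a ^ 2 * ((T - τ) * f τ ^ 2) - 2 * a * b * ((T - τ) * f τ) + b ^ 2 * (T - τ) := by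
      funext τ; ring
    have i12 : Integrable (fun τ => a ^ 2 * ((T - τ) * f τ ^ 2) - 2 * a * b * ((T - τ) * f τ))
        (volume.restrict (Set.Ioo 0 T)) := (h2.const_mul _).sub (h1.const_mul _)
    rw [e1, integral_add i12 (h0.const_mul _), integral_sub (h2.const_mul _) (h1.const_mul _),
      integral_const_mul, integral_const_mul, integral_const_mul, cesaroField_weight_integral hT.le]
    rw [← ha_def]
    ring
  rw [e] at hnn
  have h3 : 0 ≤ a * c - b ^ 2 := (mul_nonneg_iff_of_pos_left ha).1 hnn
  linarith

/-! ## Product integrability on `(0,T) × T^d` -/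

section Product

variable {d : Type*} [Fintype d] {T κ : ℝ} {u : ℝ → UnitAddTorus d → EuclideanSpace ℝ d}
  {s : ℝ → UnitAddTorus d → ℝ} {θ₀ : UnitAddTorus d → ℝ} {θ : ℝ → UnitAddTorus d → ℝ}

/-- `θ²` is integrable on `(0,T) × T^d` for a weak sourced scalar (joint measurability and the
`L^∞_t L²_x` bound; the pattern of `Torus.integrableOn_scalarL2Sq`). [folklore] -/
theorem cesaroField_integrable_sq (hW : Torus.IsWeakScalarTransportForcedOn T κ u s θ₀ θ) :
    Integrable (fun p : ℝ × UnitAddTorus d => θ p.1 p.2 ^ 2)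
      (((volume : Measure ℝ).restrict (Set.Ioo 0 T)).prod volume) := by
  obtain ⟨C, hC⟩ := hW.ae_lintegral_sq_le
  set μT : Measure ℝ := (volume : Measure ℝ).restrict (Set.Ioo 0 T) with hμT
  have hm : AEStronglyMeasurable (fun p : ℝ × UnitAddTorus d => θ p.1 p.2 ^ 2) (μT.prod volume) :=
    (continuous_pow 2).comp_aestronglyMeasurable hW.aestronglyMeasurable_uncurry
  have hfin : ∫⁻ p, ‖θ p.1 p.2 ^ 2‖ₑ ∂(μT.prod volume) < ⊤ := by
    rw [lintegral_prod _ hm.enorm]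
    have e : ∀ t x, ‖θ t x ^ 2‖ₑ = ‖θ t x‖ₑ ^ 2 := fun t x => by
      rw [Real.enorm_eq_ofReal (sq_nonneg _), Real.enorm_eq_ofReal_abs, ← ENNReal.ofReal_pow (abs_nonneg _),
        sq_abs]
    simp_rw [e]
    calc ∫⁻ t, ∫⁻ x, ‖θ t x‖ₑ ^ 2 ∂volume ∂μT ≤ ∫⁻ _, (C : ℝ≥0∞) ∂μT := lintegral_mono_ae hC
      _ < ⊤ := by rw [lintegral_const]; exact ENNReal.mul_lt_top ENNReal.coe_lt_top (measure_lt_top _ _)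
  exact ⟨hm, hfin⟩

/-- Multiplying a function integrable on `(0,T) × T^d` by the bounded weight `T − τ` keeps it
integrable. [folklore] -/
theorem cesaroField_integrable_weight_mul {F : ℝ × UnitAddTorus d → ℝ}
    (hF : Integrable F (((volume : Measure ℝ).restrict (Set.Ioo 0 T)).prod volume)) :
    Integrable (fun p : ℝ × UnitAddTorus d => (T - p.1) * F p)
      (((volume : Measure ℝ).restrict (Set.Ioo 0 T)).prod volume) := by
  refine hF.bdd_mul (c := T) (by fun_prop : Continuous fun p : ℝ × UnitAddTorus d => T - p.1).aestronglyMeasurable ?_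
  filter_upwards [Torus.IsWeakScalarTransportForcedOn.ae_fst_mem_Ioo (d := d) T] with p hp
  rw [Real.norm_eq_abs, abs_le]
  constructor <;> linarith [hp.1, hp.2]

end Product

/-! ## The stub -/

/-- **Stub D — the weighted Cesàro field.** For a global weak sourced scalar and `T > 0` the
field `Θ_T(x) = ∫₀ᵀ (T − τ) θ(τ, x) dτ` is in `L²`, with `∫Θ_T² ≤ (T²/2) ∫₀ᵀ (T − τ)‖θ(τ)‖² dτ`
(Jensen) and `∫ Θ_T ψ = ∫₀ᵀ (T − τ) ∫θ(τ)ψ dτ` for continuous `ψ` (Fubini). [folklore] -/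
theorem stub_condensateCesaroField :
    ∀ (κ T : ℝ) (u : ℝ → UnitAddTorus (Fin 2) → EuclideanSpace ℝ (Fin 2))
      (h θ₀ : UnitAddTorus (Fin 2) → ℝ) (θ : ℝ → UnitAddTorus (Fin 2) → ℝ),
      0 < T → Torus.IsWeakScalarTransportForced κ u (fun _ => h) θ₀ θ →
      MemLp (fun x => ∫ τ in (0 : ℝ)..T, (T - τ) * θ τ x) 2 volume ∧
      ∫ x, (∫ τ in (0 : ℝ)..T, (T - τ) * θ τ x) ^ 2 ≤
        T ^ 2 / 2 * ∫ τ in (0 : ℝ)..T, (T - τ) * Torus.scalarL2Sq (θ τ) ∧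
      ∀ ψ : UnitAddTorus (Fin 2) → ℝ, Continuous ψ →
        ∫ x, (∫ τ in (0 : ℝ)..T, (T - τ) * θ τ x) * ψ x =
          ∫ τ in (0 : ℝ)..T, (T - τ) * ∫ x, θ τ x * ψ x := by
  intro κ T u h θ₀ θ hT hθ
  have hW := hθ T hT
  set μT : Measure ℝ := (volume : Measure ℝ).restrict (Set.Ioo 0 T) with hμT
  -- interval integrals over `0..T` are integrals against `μT`
  have hconv : ∀ f : ℝ → ℝ, ∫ τ in (0 : ℝ)..T, f τ = ∫ τ, f τ ∂μT := fun f => by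
    rw [intervalIntegral.integral_of_le hT.le, integral_Ioc_eq_integral_Ioo]
  simp only [hconv]
  -- product integrability of `(T - τ) θ` and `(T - τ) θ²`
  have iθ : Integrable (fun p : ℝ × UnitAddTorus (Fin 2) => (T - p.1) * θ p.1 p.2) (μT.prod volume) :=
    cesaroField_integrable_weight_mul hW.integrable_uncurry
  have iθ2 : Integrable (fun p : ℝ × UnitAddTorus (Fin 2) => (T - p.1) * θ p.1 p.2 ^ 2) (μT.prod volume) :=
    cesaroField_integrable_weight_mul (cesaroField_integrable_sq hW)
  -- the pointwise (a.e. `x`) weighted Cauchy–Schwarz bound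
  have hb : ∀ᵐ x ∂(volume : Measure (UnitAddTorus (Fin 2))),
      (∫ τ, (T - τ) * θ τ x ∂μT) ^ 2 ≤ T ^ 2 / 2 * ∫ τ, (T - τ) * θ τ x ^ 2 ∂μT := by
    filter_upwards [iθ.prod_left_ae, iθ2.prod_left_ae] with x hx1 hx2
    exact cesaroField_sq_integral_le hT hx1 hx2
  have hΘi : Integrable (fun x => ∫ τ, (T - τ) * θ τ x ∂μT) volume := iθ.integral_prod_right
  have hci : Integrable (fun x => ∫ τ, (T - τ) * θ τ x ^ 2 ∂μT) volume := iθ2.integral_prod_right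
  have hΘ2 : Integrable (fun x => (∫ τ, (T - τ) * θ τ x ∂μT) ^ 2) volume := by
    refine (hci.const_mul (T ^ 2 / 2)).mono'
      ((continuous_pow 2).comp_aestronglyMeasurable hΘi.aestronglyMeasurable) ?_
    filter_upwards [hb] with x hx
    rw [Real.norm_eq_abs, abs_of_nonneg (sq_nonneg _)]
    exact hx
  refine ⟨(memLp_two_iff_integrable_sq hΘi.aestronglyMeasurable).2 hΘ2, ?_, ?_⟩
  · -- Jensen, integrated in `x`, then Tonelli
    have hsw : ∫ x, (∫ τ, (T - τ) * θ τ x ^ 2 ∂μT) = ∫ τ, (∫ x, (T - τ) * θ τ x ^ 2) ∂μT :=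
      (integral_integral_swap (f := fun τ x => (T - τ) * θ τ x ^ 2) iθ2).symm
    calc ∫ x, (∫ τ, (T - τ) * θ τ x ∂μT) ^ 2
        ≤ ∫ x, T ^ 2 / 2 * ∫ τ, (T - τ) * θ τ x ^ 2 ∂μT := integral_mono_ae hΘ2 (hci.const_mul _) hb
      _ = T ^ 2 / 2 * ∫ τ, (T - τ) * Torus.scalarL2Sq (θ τ) ∂μT := by
          rw [integral_const_mul, hsw]
          congr 1
          refine integral_congr_ae (ae_of_all _ fun τ => ?_)
          simp only [Torus.scalarL2Sq]
          exact integral_const_mul _ _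
  · -- Fubini against a continuous (bounded) test function
    intro ψ hψ
    obtain ⟨C, hC⟩ := Torus.exists_forall_norm_le_of_continuous hψ
    have iψ : Integrable (fun p : ℝ × UnitAddTorus (Fin 2) => (T - p.1) * θ p.1 p.2 * ψ p.2)
        (μT.prod volume) :=
      iθ.mul_bdd (hψ.comp continuous_snd).aestronglyMeasurable (ae_of_all _ fun p => hC p.2)
    calc ∫ x, (∫ τ, (T - τ) * θ τ x ∂μT) * ψ x
        = ∫ x, (∫ τ, (T - τ) * θ τ x * ψ x ∂μT) :=
          integral_congr_ae (ae_of_all _ fun x => (integral_mul_const _ _).symm)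
      _ = ∫ τ, (∫ x, (T - τ) * θ τ x * ψ x) ∂μT :=
          (integral_integral_swap (f := fun τ x => (T - τ) * θ τ x * ψ x) iψ).symm
      _ = ∫ τ, (T - τ) * (∫ x, θ τ x * ψ x) ∂μT := by
          refine integral_congr_ae (ae_of_all _ fun τ => ?_)
          simp only [mul_assoc]
          exact integral_const_mul _ _

end Summit.AnomalousDissipation.AnomalousDissipation.Theorems.TwohalfdNeg.Condensate
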